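import Literature.NumberTheory.Automorphic.CDTTheorem722
import Literature.NumberTheory.Automorphic.CDTTheorem722SerreProofs
import Literature.NumberTheory.Automorphic.ShimuraCurveRibetTakahashiPeterssonTwistComparisonProofs
import Literature.NumberTheory.Automorphic.ShimuraCurveRibetTakahashiCokernelProofs
import Literature.NumberTheory.Automorphic.ShimuraCurveRibetTakahashiFreyDiophantineProofs
import Literature.NumberTheory.Automorphic.BCDTModularityModPProofs
import Literature.NumberTheory.EllipticCurves.NewformsTwistPacketProofs
import Literature.NumberTheory.EllipticCurves.QuadraticTwistNegOneLFunctionProofs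
import Literature.NumberTheory.EllipticCurves.IsogenyFrobeniusTraceHoldsProofs
import Literature.NumberTheory.EllipticCurves.IsogenyFrobeniusTraceProofs
import Literature.NumberTheory.EllipticCurves.HasseWeilGoodReductionProofs
import Literature.NumberTheory.EllipticCurves.LFunctionSmulProofs
import Literature.NumberTheory.EllipticCurves.SzpiroOfAbcProofs
import Literature.NumberTheory.EllipticCurves.SzpiroFreyConductorProofs
import Literature.NumberTheory.EllipticCurves.LutzNagellGeneralWeierstrass
import Literature.NumberTheory.EllipticCurves.LocalTorsionGoodReductionPPrimaryProofs
import Literature.NumberTheory.EllipticCurves.SerreOpenImageOrdinaryInertiaProofs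
import Literature.NumberTheory.EllipticCurves.ModularityVersionApProofs
import Literature.NumberTheory.EllipticCurves.BSDInvariantsProofs
import Literature.NumberTheory.EllipticCurves.GlobalMinimalModelProofs
import Literature.NumberTheory.EllipticCurves.MazurTorsionOrderValuationProofs
import Literature.NumberTheory.EllipticCurves.LFunctionPrimeCoeff
import Literature.NumberTheory.EllipticCurves.ManinConstantQuadraticTwistClassCertificate
import Literature.NumberTheory.EllipticCurves.MatarNekovar2019.IrreducibleOverQuadraticFieldClauseThreeProofs
import Literature.NumberTheory.GaloisRepresentations.IntegralGaloisActionProofs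
import Literature.NumberTheory.DiophantineGeometry.PastenValuationProductsProofs
import Literature.NumberTheory.DiophantineGeometry.GeneralizedFermatTwoPowerCoefficientFreyProofs
import Literature.NumberTheory.DiophantineGeometry.FreyCurveConductorTwoTwistDichotomyProofs
import Literature.NumberTheory.DiophantineGeometry.DenesEquationFreyCurveProofs
import HarnessLib

/-!
# Stub-ideation companion (k = 3, GEN 4 — family "probe the extremes") for `stub_liftFive`

Crux `FreyModularity` (stmt-ABC-11340), line `Sketch` (sha 21576c53).  Elaboration-checked statements
for `STUB-IDEAS-stub_liftFive-3.md` (gen 4).  Gen 3 (same slot) re-cut the stub to the semistable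
congruence form `LiftFiveSemistable` (DDT Cor. 3.46) and left the ORDINARY-ONLY cut
`LiftFiveSemistableOrdinary` "optional, costs the glue lemma case B ⇒ `5 ∣ abc` (gen-2 G1core, unproved)".
GEN 4 makes that glue LANDABLE by a new route and proves its assembly here:

* §1 three helper statements B1–B3, ALL PROVED here (the file's only `sorry` is the §3 engine):
  B1 (linear algebra) a `Γ_ℚ`-stable line in `E[3]` with trivial action on it or on the quotient forces
  `det(ρ̄₃(σ) − 1) = 0` for every `σ`; B2 (Frobenius bookkeeping) that eigenvalue-`1` condition gives
  `3 ∣ #Ẽ(𝔽_p)` at every good prime `p ≠ 3` of a globally minimal model; B3 the Frey curve has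
  `4 ∣ #E(ℚ)_tors` (full rational `2`-torsion).
* §2 PROVED from B1–B3 + the landed S14 shape (`stub_freyCaseBThreeReducible`): in case B, `5 ∣ ab(a+b)`
  — because otherwise a global minimal model `W₀` of `E_(a,b)` has good reduction at `5` with
  `12 ∣ #W̃₀(𝔽₅) ≤ 11` (`torsionOrder_dvd_reductionPointCount`, `reductionPointCount_le_two_mul_add_one`);
  hence `E_(a,b)` is multiplicative (= ordinary) at `5` and `5 ∣ N_E` (S15-shape at `5`).  The passage
  from a general pair to a seminormalised one (`A ≡ −1 (4)`, `2 ∣ B`) carries the relation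
  `AB(A+B) = ± ab(a+b)` and uses only the landed case-B transports (`hneg/hswap/htrans` shapes).
  Prime-indexed corollary `hasMultiplicativeReductionAtPrime_five_of_caseB` = the local hypothesis of
  k1-gen-5's `MultLiftFive`.
* §3 the ordinary-only engine `LiftFiveSemistableOrdinary` (Wiles 1995 Thm 0.2 in the Selmer /
  multiplicative case only — no flat deformation theory) with its closers from the registered
  `stub_liftFive` shape and the case-B consumer, kernel-checked.

Imports are Literature-only (the `DefiniteXi…` summit modules are `remote:stale:…:unbuilt` on the farm
snapshot); landed summit facts enter as hypotheses in their registered shapes.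
-/

noncomputable section

open scoped MatrixGroups NumberField
open Literature.NumberTheory.EllipticCurves
open Literature.NumberTheory.EllipticCurves.ModularForms
open Literature.NumberTheory.Automorphic
open Literature.NumberTheory.Automorphic.BCDT
open Literature.NumberTheory.GaloisRepresentations
open Literature.NumberTheory.DiophantineGeometry
open WeierstrassCurve IsDedekindDomain Rat.HeightOneSpectrum

namespace Summit.ABC.ABC.Cruxes.FreyModularity.StubIdeas.LiftFive3g4

/-- "Case B at `3`" for the presentation `(A, B)`: no framed model of `E_(A,B)[3]` is absolutely
irreducible over `ℚ(√-3)` (the skeleton's `hB`; same body as gen 3). -/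
def CaseB (A B : ℤ) : Prop :=
  ∀ ρ₃ : ModPGaloisRep ℚ (ZMod 3) 2, (freyCurve A B).IsTorsionGaloisRep 3 ρ₃ →
    ¬ ρ₃.IsAbsIrreducibleOverSqrt (-3)

/-- The landed S14 shape (`Summit.ABC.ABC.Theorems.stub_freyCaseBThreeReducible`, verbatim): in case B the
`3`-torsion of a seminormalised Frey curve has a `Γ_ℚ`-stable line with trivial action on it or on the
quotient. [cite: Serre1972, §5.4 Prop. 21] -/
def S14Shape : Prop :=
  ∀ (A B : ℤ) [(freyCurve A B).IsElliptic], IsCoprime A B → A * B * (A + B) ≠ 0 →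
    A ≡ -1 [ZMOD 4] → (2 : ℤ) ∣ B →
    (∀ ρ₃ : ModPGaloisRep ℚ (ZMod 3) 2, (freyCurve A B).IsTorsionGaloisRep 3 ρ₃ →
      ¬ ρ₃.IsAbsIrreducibleOverSqrt (-3)) →
    ∃ H : AddSubgroup (geomTorsion (freyCurve A B) (3 : ℕ)),
      (∀ σ : Field.absoluteGaloisGroup ℚ, ∀ P ∈ H, σ • P ∈ H) ∧ H ≠ ⊥ ∧ H ≠ ⊤ ∧
      ((∀ σ : Field.absoluteGaloisGroup ℚ, ∀ P ∈ H, σ • P = P) ∨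
        ∀ (σ : Field.absoluteGaloisGroup ℚ) (Q : geomTorsion (freyCurve A B) (3 : ℕ)),
          σ • Q - Q ∈ H)

/-! ## §1 The helper lemmas B1–B3 (shapes, then proofs — all three are PROVED in this file) -/

/-- **B1 shape.** A framed `ρ̄` of `W[3]` and a proper nonzero subgroup `H ⊂ W[3]` on which `Γ_ℚ` acts
trivially, or with `σ Q − Q ∈ H` for all `Q` (trivial action on `W[3]/H`): every `ρ̄(σ)` has the
eigenvalue `1`, i.e. `det(ρ̄(σ) − 1) = 0`. Pure linear algebra over `𝔽₃`. [folklore] -/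
def B1Shape : Prop :=
  ∀ (W : WeierstrassCurve ℚ) (ρ : ModPGaloisRep ℚ (ZMod 3) 2), W.IsTorsionGaloisRep 3 ρ →
    ∀ H : AddSubgroup (geomTorsion W (3 : ℕ)), H ≠ ⊥ → H ≠ ⊤ →
    ((∀ σ : Field.absoluteGaloisGroup ℚ, ∀ P ∈ H, σ • P = P) ∨
      ∀ (σ : Field.absoluteGaloisGroup ℚ) (Q : geomTorsion W (3 : ℕ)), σ • Q - Q ∈ H) →
    ∀ σ : Field.absoluteGaloisGroup ℚ,
      Matrix.det (((ρ σ : GL (Fin 2) (ZMod 3)) : Matrix (Fin 2) (Fin 2) (ZMod 3)) - 1) = 0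

/-- **B2 shape.** For a globally minimal elliptic `W/ℚ`, a good prime `p ≠ 3` and a framed `ρ̄` of `W[3]`
all of whose elements have the eigenvalue `1`: `3 ∣ #W̃(𝔽_p)` (`reductionPointCount`).  Route:
`charpoly ρ̄(Frob_p) = X² − ā_p X + p̄` (`IsTorsionGaloisRep.charpoly_eq_of_isArithFrobAt` with the
discharged `trace_/det_galoisRepTate_frobenius_of_hasGoodReductionAt_holds`,
`frobeniusTraceAt_eq_frobeniusTrace`), `det(M − 1) = det M − tr M + 1` on `Fin 2`, and
`#W̃(𝔽_p) = p + 1 − a_p` (`frobeniusTrace`, by definition). [cite: SilvermanAEC2009, C.21 Remark 21.3] -/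
def B2Shape : Prop :=
  ∀ (W : WeierstrassCurve ℚ) [W.IsElliptic] [W.IsGloballyMinimal] (p : ℕ) [Fact p.Prime], p ≠ 3 →
    W.HasGoodReductionAtPrime p → ∀ (ρ : ModPGaloisRep ℚ (ZMod 3) 2), W.IsTorsionGaloisRep 3 ρ →
    (∀ σ : Field.absoluteGaloisGroup ℚ,
      Matrix.det (((ρ σ : GL (Fin 2) (ZMod 3)) : Matrix (Fin 2) (Fin 2) (ZMod 3)) - 1) = 0) →
    3 ∣ W.reductionPointCount p

/-- **B3 shape.** The Frey–Hellegouarch curve `y² = x(x − A)(x + B)` (`AB(A+B) ≠ 0`) has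
`4 ∣ #E(ℚ)_tors`: the three rational points `(0,0), (A,0), (−B,0)` of order `2`
(`freyCurve_two_torsion`) and `O` form a Klein four-group inside the finite group `E(ℚ)_tors`
(`finite_torsion_rat`), so Lagrange (`AddSubgroup.card_dvd_of_le`) gives `4 ∣ torsionOrder`.
[cite: DarmonMerel1997, Lemma 1.2 (1)] [cite: SilvermanAEC2009, §VIII.7 (p. 240)] -/
def B3Shape : Prop :=
  ∀ (A B : ℤ), A * B * (A + B) ≠ 0 → 4 ∣ (freyCurve A B).torsionOrder

/-- **B1 (proved).** [folklore] -/
theorem det_sub_one_eq_zero_of_stableLine : B1Shape := by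
  intro W ρ hρ H hbot htop htriv σ
  haveI : Fact (Nat.Prime 3) := ⟨Nat.prime_three⟩
  obtain ⟨e, he⟩ := hρ
  set M : Matrix (Fin 2) (Fin 2) (ZMod 3) :=
    ((ρ σ : GL (Fin 2) (ZMod 3)) : Matrix (Fin 2) (Fin 2) (ZMod 3)) with hM
  have hMv : ∀ Q : geomTorsion W (3 : ℕ), (M - 1).mulVec (e Q) = e (σ • Q - Q) := by
    intro Q
    rw [Matrix.sub_mulVec, Matrix.one_mulVec, map_sub, he]
  rcases htriv with hfix | hquot
  · obtain ⟨P, hPH, hP0⟩ := (AddSubgroup.bot_or_exists_ne_zero H).resolve_left hbot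
    refine Matrix.exists_mulVec_eq_zero_iff.mp ⟨e P, fun h ↦ hP0 ((map_eq_zero_iff e e.injective).mp h), ?_⟩
    rw [hMv, hfix σ P hPH, sub_self, map_zero]
  · by_contra hne
    have hsurj : Function.Surjective (M - 1).mulVec :=
      Matrix.mulVec_surjective_iff_isUnit.mpr ((Matrix.isUnit_iff_isUnit_det _).mpr (Ne.isUnit hne))
    apply htop
    rw [eq_top_iff]
    intro P _
    obtain ⟨w, hw⟩ := hsurj (e P)
    obtain ⟨Q, rfl⟩ := e.surjective w
    rw [hMv] at hw
    rw [← e.injective hw]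
    exact hquot σ Q

/-- `det (M - 1) = det M - tr M + 1` for a `2 × 2` matrix. [folklore] -/
theorem det_sub_one_fin_two {R : Type*} [CommRing R] (M : Matrix (Fin 2) (Fin 2) R) :
    (M - 1).det = M.det - M.trace + 1 := by
  rw [Matrix.det_fin_two, Matrix.det_fin_two, Matrix.trace_fin_two]
  simp only [Matrix.sub_apply, Matrix.one_apply_eq, Matrix.one_apply_ne (by decide : (0 : Fin 2) ≠ 1),
    Matrix.one_apply_ne (by decide : (1 : Fin 2) ≠ 0)]
  ring

/-- Trace and determinant of a `2 × 2` matrix whose characteristic polynomial is `X² − a X + q`.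
[folklore] -/
theorem trace_det_of_charpoly_eq {F : Type*} [Field F] (M : Matrix (Fin 2) (Fin 2) F) {a q : F}
    (h : M.charpoly = Polynomial.X ^ 2 - Polynomial.C a * Polynomial.X + Polynomial.C q) :
    M.trace = a ∧ M.det = q := by
  constructor
  · rw [Matrix.trace_eq_neg_charpoly_coeff, h]
    simp [Fintype.card_fin, Polynomial.coeff_C]
  · rw [Matrix.det_eq_sign_charpoly_coeff, h]
    simp [Fintype.card_fin, Polynomial.coeff_C]

/-- **B2 (proved).** [cite: SilvermanAEC2009, C.21 Remark 21.3] -/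
theorem three_dvd_reductionPointCount_of_det_sub_one : B2Shape := by
  intro W _ _ p _ hp3 hgood ρ hρ hdet
  haveI : Fact (Nat.Prime 3) := ⟨Nat.prime_three⟩
  obtain ⟨v, hv⟩ : ∃ v : HeightOneSpectrum (𝓞 ℚ), (primesEquiv v : ℕ) = p :=
    ⟨primesEquiv.symm ⟨p, Fact.out⟩, by rw [Equiv.apply_symm_apply]⟩
  subst hv
  have hgood' : W.HasGoodReductionAt v :=
    (hasGoodReductionAtPrime_iff_hasGoodReductionAt_ringOfIntegers v W).mp hgood
  obtain ⟨𝔓, h𝔓⟩ := HeightOneSpectrum.primesAbove_nonempty v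
  obtain ⟨σ, hσ⟩ := HeightOneSpectrum.exists_isArithFrobAt_of_mem_primesAbove_holds h𝔓
  have h3v : ((3 : ℕ) : 𝓞 ℚ) ∉ v.asIdeal := natCast_not_mem_asIdeal_of_primesEquiv_ne Nat.prime_three hp3
  have hch := hρ.charpoly_eq_of_isArithFrobAt (W.trace_galoisRepTate_frobenius_of_hasGoodReductionAt_holds 3)
    (W.det_galoisRepTate_frobenius_of_hasGoodReductionAt_holds 3) h3v hgood' h𝔓 hσ
  rw [natCard_residueField_adicCompletionIntegers, frobeniusTraceAt_eq_frobeniusTrace] at hch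
  obtain ⟨htr, hdt⟩ := trace_det_of_charpoly_eq _ hch
  have h1 := hdet σ
  rw [det_sub_one_fin_two, htr, hdt] at h1
  -- `h1 : (p : ZMod 3) - (a_p : ZMod 3) + 1 = 0`, and `N_p = p + 1 - a_p`
  have hN : ((W.reductionPointCount (primesEquiv v : ℕ) : ℤ) : ZMod 3) = 0 := by
    have hdef : (W.reductionPointCount (primesEquiv v : ℕ) : ℤ) =
        (primesEquiv v : ℕ) + 1 - W.frobeniusTrace (primesEquiv v : ℕ) := by
      unfold WeierstrassCurve.frobeniusTrace; ring
    rw [hdef]; push_cast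
    linear_combination h1
  have h3 : ((3 : ℕ) : ℤ) ∣ (W.reductionPointCount (primesEquiv v : ℕ) : ℤ) :=
    (ZMod.intCast_zmod_eq_zero_iff_dvd _ 3).mp hN
  exact_mod_cast h3

/-- **B3 (proved).** The Klein four-group `{O, (0,0), (A,0), (−B,0)} ⊂ E(ℚ)_tors`: an injective
homomorphism `ℤ/2 × ℤ/2 →+ E(ℚ)_tors`, `(i, j) ↦ i·(0,0) + j·(A,0)`, and Lagrange
(`AddSubgroup.card_dvd_of_injective`). [cite: DarmonMerel1997, Lemma 1.2 (1)] -/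
theorem four_dvd_torsionOrder_freyCurve : B3Shape := by
  intro A B h0
  haveI := isElliptic_freyCurve h0
  obtain ⟨hP, hPne, hP2⟩ := freyCurve_two_torsion h0 (r := (0 : ℚ)) (Or.inl rfl)
  obtain ⟨hQ, hQne, hQ2⟩ := freyCurve_two_torsion h0 (r := (A : ℚ)) (Or.inr (Or.inl rfl))
  -- the two generators and their distinctness
  have hPQ : (Affine.Point.some 0 0 hP : (freyCurve A B).toAffine.Point) ≠ Affine.Point.some (A : ℚ) 0 hQ := by
    intro h
    simp only [Affine.Point.some.injEq, and_true] at h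
    have hA : A = 0 := by exact_mod_cast h.symm
    apply h0; rw [hA]; ring
  have hPfin : IsOfFinAddOrder (Affine.Point.some 0 0 hP : (freyCurve A B).toAffine.Point) :=
    isOfFinAddOrder_iff_nsmul_eq_zero.mpr ⟨2, by norm_num, by rw [two_nsmul]; exact hP2⟩
  have hQfin : IsOfFinAddOrder (Affine.Point.some (A : ℚ) 0 hQ : (freyCurve A B).toAffine.Point) :=
    isOfFinAddOrder_iff_nsmul_eq_zero.mpr ⟨2, by norm_num, by rw [two_nsmul]; exact hQ2⟩
  set T := AddCommGroup.torsion (freyCurve A B).toAffine.Point with hT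
  set P' : T := ⟨Affine.Point.some 0 0 hP, hPfin⟩ with hP'
  set Q' : T := ⟨Affine.Point.some (A : ℚ) 0 hQ, hQfin⟩ with hQ'
  have hP'2 : (2 : ℤ) • P' = 0 := Subtype.ext (by rw [two_zsmul]; exact hP2)
  have hQ'2 : (2 : ℤ) • Q' = 0 := Subtype.ext (by rw [two_zsmul]; exact hQ2)
  have hP'ne : P' ≠ 0 := fun h ↦ hPne (congrArg Subtype.val h)
  have hQ'ne : Q' ≠ 0 := fun h ↦ hQne (congrArg Subtype.val h)
  have hP'Q' : P' + Q' ≠ 0 := by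
    intro h
    have h' : (Affine.Point.some 0 0 hP : (freyCurve A B).toAffine.Point) + Affine.Point.some (A : ℚ) 0 hQ = 0 :=
      congrArg Subtype.val h
    have hnegQ : -(Affine.Point.some (A : ℚ) 0 hQ : (freyCurve A B).toAffine.Point) =
        Affine.Point.some (A : ℚ) 0 hQ := by
      rw [neg_eq_iff_add_eq_zero, hQ2]
    exact hPQ (by rw [← hnegQ]; exact eq_neg_of_add_eq_zero_left h')
  -- the homomorphism `ℤ/2 × ℤ/2 →+ T`
  let fP : ZMod 2 →+ T := ZMod.lift 2 ⟨zmultiplesHom T P', by simpa using hP'2⟩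
  let fQ : ZMod 2 →+ T := ZMod.lift 2 ⟨zmultiplesHom T Q', by simpa using hQ'2⟩
  have hfP : ∀ k : ℤ, fP (k : ZMod 2) = k • P' := fun k ↦ by
    simp only [fP, ZMod.lift_coe]; rfl
  have hfQ : ∀ k : ℤ, fQ (k : ZMod 2) = k • Q' := fun k ↦ by
    simp only [fQ, ZMod.lift_coe]; rfl
  have hf1P : fP 1 = P' := by have h := hfP 1; rwa [Int.cast_one, one_zsmul] at h
  have hf1Q : fQ 1 = Q' := by have h := hfQ 1; rwa [Int.cast_one, one_zsmul] at h
  have h01 : ∀ i : ZMod 2, i = 0 ∨ i = 1 := by decide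
  have hinj : Function.Injective (fP.coprod fQ) := by
    rw [injective_iff_map_eq_zero]
    rintro ⟨i, j⟩ h
    rw [AddMonoidHom.coprod_apply] at h
    rcases h01 i with rfl | rfl <;> rcases h01 j with rfl | rfl
    · rfl
    · rw [map_zero, zero_add, hf1Q] at h; exact absurd h hQ'ne
    · rw [map_zero, add_zero, hf1P] at h; exact absurd h hP'ne
    · rw [hf1P, hf1Q] at h; exact absurd h hP'Q'
  have hcard : Nat.card (ZMod 2 × ZMod 2) ∣ Nat.card T := AddSubgroup.card_dvd_of_injective _ hinj
  rw [Nat.card_prod, Nat.card_zmod] at hcard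
  rw [torsionOrder_eq_natCard_torsion]
  exact hcard

/-! ## §2 The assembly: case B ⇒ `5 ∣ ab(a+b)` ⇒ multiplicative (ordinary) at `5`, `5 ∣ N` -/

/-- `12 ∤ #W̃(𝔽₅)`: `0 < #W̃(𝔽₅) ≤ 2·5 + 1`. [cite: SilvermanAEC2009, Exercise 5.10] -/
theorem not_twelve_dvd_reductionPointCount_five (W : WeierstrassCurve ℚ) [W.IsGloballyMinimal] :
    ¬ 12 ∣ W.reductionPointCount 5 := by
  haveI : Fact (Nat.Prime 5) := ⟨by norm_num⟩
  haveI : NeZero (5 : ℕ) := ⟨by norm_num⟩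
  intro h
  have h1 := reductionPointCount_le_two_mul_add_one W 5
  have h2 := reductionPointCount_pos W 5
  omega

/-- An odd prime `q ∣ ab(a+b)` divides `N_{E_(a,b)}` (`v_q(Δ_min) = 2 v_q(ab(a+b)) ≥ 2`, and `N`, `Δ_min`
have the same primes). [cite: PastenShimura2024, §16.4 p. 51] -/
theorem dvd_conductorNorm_freyCurve_of_dvd {a b : ℤ} (hab : IsCoprime a b) (h0 : a * b * (a + b) ≠ 0)
    {q : ℕ} (hq : q.Prime) (hq2 : q ≠ 2) (hqd : (q : ℤ) ∣ a * b * (a + b)) :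
    q ∣ (freyCurve a b).conductorNorm ℤ := by
  haveI := isElliptic_freyCurve h0
  haveI : Fact q.Prime := ⟨hq⟩
  refine dvd_conductorNorm_of_factorization_ne_zero _ ?_
  rw [factorization_minimalDiscriminantNorm_freyCurve_of_ne_two hab h0 hq hq2]
  have h1 : 1 ≤ padicValNat q (a * b * (a + b)).natAbs :=
    one_le_padicValNat_of_dvd (Int.natAbs_ne_zero.mpr h0) (Int.natCast_dvd.mp hqd)
  omega

/-- `5 ∣ N_{E_(a,b)} ⇒ 5 ∣ ab(a+b)` (`N ∣ 2⁸ rad(ab(a+b))`, `conductorNorm_freyCurve_dvd_holds`). [cite: Frey1986] -/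
theorem five_dvd_of_five_dvd_conductorNorm_freyCurve {a b : ℤ} (hab : IsCoprime a b)
    (h0 : a * b * (a + b) ≠ 0) (h : 5 ∣ (freyCurve a b).conductorNorm ℤ) : (5 : ℤ) ∣ a * b * (a + b) := by
  have h' : 5 ∣ 2 ^ 8 * (UniqueFactorizationMonoid.radical (a * b * (a + b))).natAbs :=
    h.trans (conductorNorm_freyCurve_dvd_holds a b hab h0)
  have h5r : 5 ∣ (UniqueFactorizationMonoid.radical (a * b * (a + b))).natAbs :=
    (by norm_num : Nat.Coprime 5 (2 ^ 8)).dvd_of_dvd_mul_left h'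
  exact (Int.natCast_dvd.mpr h5r).trans UniqueFactorizationMonoid.radical_dvd_self

/-- **G1core, seminormalised (PROVED from S14 + B1 + B2 + B3).**  For coprime `A, B` with `AB(A+B) ≠ 0`,
`A ≡ −1 (mod 4)`, `2 ∣ B`, `E_(A,B)` in case B at `3`: `5 ∣ AB(A+B)`.  Otherwise `E` is good at `5`;
on a global minimal model `W₀ ≅ E` (`hasGlobalMinimalModel_rat_holds`): `4 ∣ #E(ℚ)_tors = #W₀(ℚ)_tors ∣
#W̃₀(𝔽₅)` (B3, `torsionOrder_variableChange_holds`, Knapp 5.1(c) `torsionOrder_dvd_reductionPointCount`),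
and `3 ∣ #W̃₀(𝔽₅)` (S14 → B1 → B2, framing transported by `isTorsionGaloisRep_smul`); so
`12 ∣ #W̃₀(𝔽₅) ≤ 11`. [cite: Knapp1993, Ch. V §1 Thm. 5.1(c)] [cite: Serre1972, §5.4 Prop. 21] -/
theorem five_dvd_of_caseB_seminormalised (hS14 : S14Shape) (hB1 : B1Shape) (hB2 : B2Shape)
    (hB3 : B3Shape) {A B : ℤ} (hAB : IsCoprime A B) (h0 : A * B * (A + B) ≠ 0)
    (hA : A ≡ -1 [ZMOD 4]) (h2 : (2 : ℤ) ∣ B) (hB : CaseB A B) : (5 : ℤ) ∣ A * B * (A + B) := by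
  by_contra h5
  haveI := isElliptic_freyCurve h0
  haveI : Fact (Nat.Prime 5) := ⟨by norm_num⟩
  haveI : Fact (Nat.Prime 3) := ⟨Nat.prime_three⟩
  haveI : NeZero ((3 : ℕ) : ℚ) := ⟨by norm_num⟩
  -- `5 ∤ N_E`
  have hN : ¬ 5 ∣ (freyCurve A B).conductorNorm ℤ := fun h ↦
    h5 (five_dvd_of_five_dvd_conductorNorm_freyCurve hAB h0 h)
  -- a global minimal model `W₀ = C • E`, good at `5`
  obtain ⟨C, hC⟩ := hasGlobalMinimalModel_rat_holds (freyCurve A B)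
  haveI := hC
  have hN₀ : ¬ 5 ∣ (C • freyCurve A B).conductorNorm ℤ := by
    rwa [conductorNorm_smul_rat]
  have hgood : (C • freyCurve A B).HasGoodReductionAtPrime 5 := by
    by_contra hbad
    exact hN₀ ((dvd_conductorNorm_iff_not_hasGoodReductionAtPrime _ 5).mpr hbad)
  have hΔ := not_dvd_minimalDiscriminantInt_of_hasGoodReductionAtPrime' (C • freyCurve A B) 5 hgood
  -- `4 ∣ #W̃₀(𝔽₅)`
  have h4 : 4 ∣ (C • freyCurve A B).reductionPointCount 5 := by
    have ht : (C • freyCurve A B).torsionOrder = (freyCurve A B).torsionOrder :=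
      torsionOrder_variableChange_holds (freyCurve A B) C
    have h4t : 4 ∣ (C • freyCurve A B).torsionOrder := by
      rw [ht]; exact hB3 A B h0
    exact h4t.trans
      (LutzNagellGeneral.torsionOrder_dvd_reductionPointCount _ 5 (Or.inl (by decide)) hΔ)
  -- `3 ∣ #W̃₀(𝔽₅)`
  have h3 : 3 ∣ (C • freyCurve A B).reductionPointCount 5 := by
    obtain ⟨ρ, hρ⟩ := (freyCurve A B).exists_isTorsionGaloisRep 3
    obtain ⟨H, -, hbot, htop, htriv⟩ := hS14 A B hAB h0 hA h2 hB
    have hdet := hB1 (freyCurve A B) ρ hρ H hbot htop htriv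
    exact hB2 (C • freyCurve A B) 5 (by decide) hgood ρ
      (MatarNekovar2019.isTorsionGaloisRep_smul (freyCurve A B) C hρ) hdet
  exact not_twelve_dvd_reductionPointCount_five (C • freyCurve A B)
    (Nat.Coprime.mul_dvd_of_dvd_of_dvd (by norm_num : Nat.Coprime 4 3) h4 h3)

/-- Coprime integers are not both even. [folklore] -/
theorem not_two_dvd_both_of_isCoprime {a b : ℤ} (hab : IsCoprime a b) : ¬ ((2 : ℤ) ∣ a ∧ (2 : ℤ) ∣ b) := by
  rintro ⟨ha, hb⟩
  have hu := hab.isUnit_of_dvd' ha hb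
  norm_num [Int.isUnit_iff] at hu

/-- **Seminormalisation with the product relation** (Diamond–Kramer 1995, Lemma 1, only as far as S14
needs: `A ≡ −1 (mod 4)`, `2 ∣ B`), carrying `AB(A+B) = ± ab(a+b)`.  The three transports are the landed
`Summit.ABC.ABC.Theorems.caseBThree_freyCurve_neg / _swap / _translate_iff` in their registered shapes.
[cite: DiamondKramer1995, Lemma 1] -/
theorem exists_seminormalised_caseB
    (hneg : ∀ A B : ℤ, CaseB A B → CaseB (-A) (-B))
    (hswap : ∀ a b : ℤ, CaseB a b → CaseB b a)
    (htrans : ∀ a b : ℤ, CaseB a b → CaseB (-a) (a + b))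
    {a b : ℤ} (hab : IsCoprime a b) (h0 : a * b * (a + b) ≠ 0) (hB : CaseB a b) :
    ∃ A B : ℤ, IsCoprime A B ∧ A * B * (A + B) ≠ 0 ∧ A ≡ -1 [ZMOD 4] ∧ (2 : ℤ) ∣ B ∧ CaseB A B ∧
      (A * B * (A + B) = a * b * (a + b) ∨ A * B * (A + B) = -(a * b * (a + b))) := by
  -- the sign fix for `A` odd, `B` even
  have key : ∀ {A B : ℤ}, IsCoprime A B → A * B * (A + B) ≠ 0 → ¬ (2 : ℤ) ∣ A → (2 : ℤ) ∣ B →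
      CaseB A B →
      ∃ A' B' : ℤ, IsCoprime A' B' ∧ A' * B' * (A' + B') ≠ 0 ∧ A' ≡ -1 [ZMOD 4] ∧ (2 : ℤ) ∣ B' ∧
        CaseB A' B' ∧
        (A' * B' * (A' + B') = A * B * (A + B) ∨ A' * B' * (A' + B') = -(A * B * (A + B))) := by
    intro A B hAB h0 hA h2 hB
    by_cases h4 : A ≡ -1 [ZMOD 4]
    · exact ⟨A, B, hAB, h0, h4, h2, hB, Or.inl rfl⟩
    · refine ⟨-A, -B, hAB.neg_neg, ?_, ?_, (dvd_neg).mpr h2, hneg A B hB, Or.inr (by ring)⟩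
      · rw [show (-A) * (-B) * (-A + -B) = -(A * B * (A + B)) by ring]; exact neg_ne_zero.mpr h0
      · unfold Int.ModEq at h4 ⊢; omega
  have hnot := not_two_dvd_both_of_isCoprime hab
  by_cases hb : (2 : ℤ) ∣ b
  · exact key hab h0 (fun ha ↦ hnot ⟨ha, hb⟩) hb hB
  · by_cases ha : (2 : ℤ) ∣ a
    · have h0' : b * a * (b + a) ≠ 0 := by
        rwa [show b * a * (b + a) = a * b * (a + b) by ring]
      obtain ⟨A, B, h1, h2', h3, h4, h5, h6⟩ := key hab.symm h0' hb ha (hswap a b hB)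
      refine ⟨A, B, h1, h2', h3, h4, h5, ?_⟩
      rcases h6 with h | h
      · left; rw [h]; ring
      · right; rw [h]; ring
    · have hab2 : (2 : ℤ) ∣ a + b := by omega
      have h0' : (-a) * (a + b) * (-a + (a + b)) ≠ 0 := by
        rw [show (-a) * (a + b) * (-a + (a + b)) = -(a * b * (a + b)) by ring]
        exact neg_ne_zero.mpr h0
      have hcop : IsCoprime (-a) (a + b) := by
        have h := (hab.add_mul_left_right 1).neg_left
        rwa [mul_one, add_comm] at h
      obtain ⟨A, B, h1, h2', h3, h4, h5, h6⟩ :=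
        key hcop h0' (fun h ↦ ha ((dvd_neg).mp h)) hab2 (htrans a b hB)
      refine ⟨A, B, h1, h2', h3, h4, h5, ?_⟩
      rcases h6 with h | h
      · right; rw [h]; ring
      · left; rw [h]; ring

/-- **G1core (general pair; PROVED modulo B3 and the landed shapes).**  In case B at `3`, `5 ∣ ab(a+b)`.
[cite: Knapp1993, Ch. V §1 Thm. 5.1(c)] [cite: DiamondKramer1995, Lemma 1] -/
theorem five_dvd_of_caseB
    (hneg : ∀ A B : ℤ, CaseB A B → CaseB (-A) (-B))
    (hswap : ∀ a b : ℤ, CaseB a b → CaseB b a)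
    (htrans : ∀ a b : ℤ, CaseB a b → CaseB (-a) (a + b))
    (hS14 : S14Shape) (hB1 : B1Shape) (hB2 : B2Shape) (hB3 : B3Shape)
    {a b : ℤ} (hab : IsCoprime a b) (h0 : a * b * (a + b) ≠ 0) (hB : CaseB a b) :
    (5 : ℤ) ∣ a * b * (a + b) := by
  obtain ⟨A, B, hAB, h0', hA, h2, hB', hrel⟩ := exists_seminormalised_caseB hneg hswap htrans hab h0 hB
  have h5 := five_dvd_of_caseB_seminormalised hS14 hB1 hB2 hB3 hAB h0' hA h2 hB'
  rcases hrel with h | h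
  · rwa [h] at h5
  · rw [h] at h5; exact (dvd_neg).mp h5

/-- **G1 (the S15 shape at `5`).**  In case B at `3`: `5 ∣ ab(a+b)` and `E_(a,b)` has multiplicative
reduction at the place `5` (`hasMultiplicativeReductionAt_freyCurve_of_ne_two`), i.e. `ρ_{E,5}|_{D₅}` is
ordinary (Tate curve). [cite: DiamondKramer1995, Lemma 2] [cite: Wiles1995Annals, Thm. 0.2 (I)] -/
theorem five_dvd_and_hasMultiplicativeReductionAt_five_of_caseB
    (hneg : ∀ A B : ℤ, CaseB A B → CaseB (-A) (-B))
    (hswap : ∀ a b : ℤ, CaseB a b → CaseB b a)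
    (htrans : ∀ a b : ℤ, CaseB a b → CaseB (-a) (a + b))
    (hS14 : S14Shape) (hB1 : B1Shape) (hB2 : B2Shape) (hB3 : B3Shape)
    {a b : ℤ} (hab : IsCoprime a b) (h0 : a * b * (a + b) ≠ 0) (hB : CaseB a b) :
    (5 : ℤ) ∣ a * b * (a + b) ∧
      ∀ v : HeightOneSpectrum ℤ, natGenerator v = 5 → (freyCurve a b).HasMultiplicativeReductionAt v := by
  have h5 := five_dvd_of_caseB hneg hswap htrans hS14 hB1 hB2 hB3 hab h0 hB
  refine ⟨h5, fun v hv ↦ ?_⟩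
  refine hasMultiplicativeReductionAt_freyCurve_of_ne_two hab h0 v (by rw [hv]; decide) ?_
  rw [hv]
  exact_mod_cast h5

/-- … and `5 ∣ N_{E_(a,b)}` in case B. [cite: DiamondKramer1995, Lemma 2] -/
theorem five_dvd_conductorNorm_freyCurve_of_caseB
    (hneg : ∀ A B : ℤ, CaseB A B → CaseB (-A) (-B))
    (hswap : ∀ a b : ℤ, CaseB a b → CaseB b a)
    (htrans : ∀ a b : ℤ, CaseB a b → CaseB (-a) (a + b))
    (hS14 : S14Shape) (hB1 : B1Shape) (hB2 : B2Shape) (hB3 : B3Shape)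
    {a b : ℤ} (hab : IsCoprime a b) (h0 : a * b * (a + b) ≠ 0) (hB : CaseB a b) :
    5 ∣ (freyCurve a b).conductorNorm ℤ :=
  dvd_conductorNorm_freyCurve_of_dvd hab h0 (by norm_num) (by decide)
    (five_dvd_of_caseB hneg hswap htrans hS14 hB1 hB2 hB3 hab h0 hB)

/-- **G1, prime-indexed** — exactly the local hypothesis `W.HasMultiplicativeReductionAtPrime 5` of
k1 gen-5's `MultLiftFive` (Wiles Thm. 0.2 case (I)/(Se)): in case B the Frey curve is multiplicative at
`5`. (`hasGoodReductionAtPrime_or_hasMultiplicativeReductionAtPrime_of_place` + `5 ∣ N` excludes good.)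
[cite: DiamondKramer1995, Lemma 2] [cite: SilvermanAEC2009, VII.5 Prop. 5.1] -/
theorem hasMultiplicativeReductionAtPrime_five_of_caseB
    (hneg : ∀ A B : ℤ, CaseB A B → CaseB (-A) (-B))
    (hswap : ∀ a b : ℤ, CaseB a b → CaseB b a)
    (htrans : ∀ a b : ℤ, CaseB a b → CaseB (-a) (a + b))
    (hS14 : S14Shape) (hB1 : B1Shape) (hB2 : B2Shape) (hB3 : B3Shape)
    {a b : ℤ} (hab : IsCoprime a b) (h0 : a * b * (a + b) ≠ 0) [(freyCurve a b).IsElliptic]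
    [Fact (Nat.Prime 5)] (hB : CaseB a b) : (freyCurve a b).HasMultiplicativeReductionAtPrime 5 := by
  obtain ⟨h5, hmult⟩ :=
    five_dvd_and_hasMultiplicativeReductionAt_five_of_caseB hneg hswap htrans hS14 hB1 hB2 hB3 hab h0 hB
  set v : HeightOneSpectrum ℤ := (primesEquiv (R := ℤ)).symm ⟨5, by norm_num⟩ with hv_def
  have hv : natGenerator v = 5 := WeierstrassCurve.natGenerator_primesEquiv_symm 5 (by norm_num)
  have hpv : (primesEquiv v : ℕ) = 5 := by rw [hv_def, Equiv.apply_symm_apply]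
  rcases hasGoodReductionAtPrime_or_hasMultiplicativeReductionAtPrime_of_place hpv
      (Or.inr (hmult v hv)) with hg | hm
  · exact absurd hg ((dvd_conductorNorm_iff_not_hasGoodReductionAtPrime _ 5).mp
      (dvd_conductorNorm_freyCurve_of_dvd hab h0 (by norm_num) (by decide) h5))
  · exact hm

/-! ## §3 The ordinary-only engine S2″ and its closers -/

/-- **`LiftFiveSemistable` (gen-3 shape, S2′ = DDT 1995 Cor. 3.46 at `ℓ = 5`).**
[cite: DarmonDiamondTaylor1995, Cor. 3.46] [cite: Wiles1995Annals, Thm. 0.2] -/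
def LiftFiveSemistable : Prop :=
  ∀ (W W' : WeierstrassCurve ℚ) [W.IsElliptic] [W'.IsElliptic] [NeZero (W'.conductorNorm ℤ)]
    (ρ : ModPGaloisRep ℚ (ZMod 5) 2),
    W.IsSemistable ℤ → W.IsTorsionGaloisRep 5 ρ → W'.IsTorsionGaloisRep 5 ρ →
    FramedRep.IsIrreducible ρ → BCDT.IsModular W' → W.IsModularGaloisRepTate 5

/-- **`LiftFiveSemistableOrdinary` (S2″, the engine this plan proposes to REGISTER in place of S2).**
For `W` semistable with `5 ∣ N_W` (multiplicative, hence ordinary, at `5`), `W[5] ≅ W'[5]` irreducible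
with `W'` modular: `ρ_{W,5}` is modular.  = Wiles 1995 Thm. 0.2 restricted to hypothesis (I)
"`E` has multiplicative reduction at `5`" (the Selmer case: ordinary deformation rings, `D₅`-distinguished
automatic because `χ̄₁/χ̄₂ = χ̄₅` is ramified on a Tate curve), no flat / Fontaine–Laffaille input.
[cite: Wiles1995Annals, Thm. 0.2 (I)] [cite: TaylorWiles1995, Thm. 1] -/
def LiftFiveSemistableOrdinary : Prop :=
  ∀ (W W' : WeierstrassCurve ℚ) [W.IsElliptic] [W'.IsElliptic] [NeZero (W'.conductorNorm ℤ)]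
    (ρ : ModPGaloisRep ℚ (ZMod 5) 2),
    W.IsSemistable ℤ → 5 ∣ W.conductorNorm ℤ → W.IsTorsionGaloisRep 5 ρ → W'.IsTorsionGaloisRep 5 ρ →
    FramedRep.IsIrreducible ρ → BCDT.IsModular W' → W.IsModularGaloisRepTate 5

/-- The XL engine (closed by a Literature typing of Wiles 1995 Ch. 1–3 + Taylor–Wiles in the ordinary
semistable case, or today by `CDT_theorem_7_2_2` via the closers below). -/
theorem stub_liftFiveSemistableOrdinary : LiftFiveSemistableOrdinary := by
  sorry

/-- `25 ∤ N` for a semistable curve (squarefree conductor). [folklore] -/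
theorem not_twentyFive_dvd_of_isSemistable (W : WeierstrassCurve ℚ) [W.IsElliptic]
    (h : W.IsSemistable ℤ) : ¬ 25 ∣ W.conductorNorm ℤ := by
  intro h25
  have hsq : Squarefree (W.conductorNorm ℤ) := (isSemistable_iff_squarefree_conductorNorm W).mp h
  have h5 : IsUnit (5 : ℕ) := hsq 5 ((show (5 : ℕ) * 5 = 25 by norm_num) ▸ h25)
  exact absurd (Nat.isUnit_iff.mp h5) (by norm_num)

/-- **S2 ⇒ S2″**: the ordinary cut follows from the registered `stub_liftFive` shape, granted the landed
S4b (`Summit.ABC.ABC.Theorems.stub_absIrrSqrtFive`, hypothesis `h4b`). [folklore] -/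
theorem liftFiveSemistableOrdinary_of_liftFive
    (hlift5 : ∀ (W : WeierstrassCurve ℚ) [W.IsElliptic] (ρ : ModPGaloisRep ℚ (ZMod 5) 2),
      W.IsTorsionGaloisRep 5 ρ → ρ.IsAbsIrreducibleOverSqrt 5 → ¬ 25 ∣ W.conductorNorm ℤ →
      ρ.IsModular → W.IsModularGaloisRepTate 5)
    (h4b : ∀ (W : WeierstrassCurve ℚ) [W.IsElliptic], ¬ 25 ∣ W.conductorNorm ℤ →
      ∀ ρ : ModPGaloisRep ℚ (ZMod 5) 2, W.IsTorsionGaloisRep 5 ρ →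
        FramedRep.IsIrreducible ρ → ρ.IsAbsIrreducibleOverSqrt 5) : LiftFiveSemistableOrdinary := by
  intro W W' _ _ _ ρ hss _ hρ hρ' hirr hW'
  have h25 := not_twentyFive_dvd_of_isSemistable W hss
  exact hlift5 W ρ hρ (h4b W h25 ρ hρ hirr) h25 (hW'.isModular_of_isTorsionGaloisRep'' hρ')

/-- **S2 ⇒ S2″ from the tree's umbrella fact** (`CDT_theorem_7_2_2`; the existing closer survives).
[cite: ConradDiamondTaylor1999, Thm. 7.2.2] -/
theorem liftFiveSemistableOrdinary_of_CDT_theorem_7_2_2 (h : CDT_theorem_7_2_2)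
    (h4b : ∀ (W : WeierstrassCurve ℚ) [W.IsElliptic], ¬ 25 ∣ W.conductorNorm ℤ →
      ∀ ρ : ModPGaloisRep ℚ (ZMod 5) 2, W.IsTorsionGaloisRep 5 ρ →
        FramedRep.IsIrreducible ρ → ρ.IsAbsIrreducibleOverSqrt 5) : LiftFiveSemistableOrdinary :=
  liftFiveSemistableOrdinary_of_liftFive
    (fun W _ ρ hρ hirr _ hmod ↦ lift_of_CDT_theorem_7_2_2 h W ρ hρ hirr hmod) h4b

/-- **S2′ ⇒ S2″** (trivial weakening). [folklore] -/
theorem liftFiveSemistableOrdinary_of_liftFiveSemistable (h : LiftFiveSemistable) :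
    LiftFiveSemistableOrdinary :=
  fun W W' _ _ _ ρ hss _ hρ hρ' hirr hW' ↦ h W W' ρ hss hρ hρ' hirr hW'

/-- **The case-B consumer with the ordinary engine.**  For a normalised case-B Frey curve (semistable:
S12 + Serre) with `5 ∣ AB(A+B)` (G1core above), `E[5] ≅ E'[5]` irreducible for a modular `E'` (the
skeleton's switch data): `ρ_{E,5}` is modular.  This is the only place `stub_liftFive` is consumed in
`isModular_freyCurve_of_stubs`, now served by S2″. [cite: Wiles1995Annals, Thm. 0.2 (I), Ch. 5] -/
theorem isModularGaloisRepTate_five_caseB_of_ordinary (hOrd : LiftFiveSemistableOrdinary)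
    {A B : ℤ} (hAB : IsCoprime A B) (h0 : A * B * (A + B) ≠ 0) [(freyCurve A B).IsElliptic]
    (hss : (freyCurve A B).IsSemistable ℤ) (h5 : (5 : ℤ) ∣ A * B * (A + B))
    (W' : WeierstrassCurve ℚ) [W'.IsElliptic] [NeZero (W'.conductorNorm ℤ)]
    (ρ : ModPGaloisRep ℚ (ZMod 5) 2) (hρ : (freyCurve A B).IsTorsionGaloisRep 5 ρ)
    (hρ' : W'.IsTorsionGaloisRep 5 ρ) (hirr : FramedRep.IsIrreducible ρ) (hW' : BCDT.IsModular W') :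
    (freyCurve A B).IsModularGaloisRepTate 5 :=
  hOrd (freyCurve A B) W' ρ hss (dvd_conductorNorm_freyCurve_of_dvd hAB h0 (by norm_num) (by decide) h5)
    hρ hρ' hirr hW'

end Summit.ABC.ABC.Cruxes.FreyModularity.StubIdeas.LiftFive3g4

end
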